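import Summits.FinalStateConjecture.FinalStateConjecture.Theses.PhotonSphereChannels
import Literature.Geometry.Lorentzian.TameGenericityDiagonal

/-!
# CensusS5 — positioning theorems for the independent strategy census (family `s`, seat s5)
of the crux `ChannelsResolveTameDevelopmentsR` (stmt-FinalStateConjecture-17430).

Kernel-checked content (no `sorry`):

* `QBody`, `PBody`, `TameHyps`, `ResolvedT2` — the K3 body, the summit body, the hypotheses
  (i)–(ii) of K2R and the T2 conclusion of K2R, as named predicates (defeq to the inline texts:
  `tameCensorship_iff`, `finalStateConjecture_iff`).
* `X0` (pointwise resolution `Q D → P D` on admissible data) is ALL that `closes` consumes of K2R: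
  `x0_of_k2R : ChannelsResolveTameDevelopmentsR → X0` and
  `fsc_of_x0_of_tameCensorship : X0 → TameCensorship → FinalStateConjecture`.
* The summit splits along K3's property `Q`: `fsc_iff_split : FinalStateConjecture ↔ SummitOnQ ∧
  SummitOffQ`; `X0` + K3 give the `¬Q` half (`summitOffQ_of_x0_of_tameCensorship`) and `X0`
  gives the `Q` half VACUOUSLY (`summitOnQ_of_x0`: the tame-non-settling locus `{Q ∧ ¬P}` is
  asserted EMPTY, whereas the summit only needs it TAME-MEAGRE).
* Given K3, the summit is EQUIVALENT to the exceptional-base hand-back `REL` of settling curves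
  along censored curves (`fsc_iff_rel`, an instance of the in-tree
  `isTameChristodoulouGeneric_iff_relative_exceptional`): the weakest K2R-replacement modulo K3 is
  `REL`, which is summit-strength relative to K3; `rel_of_x0 : X0 → REL`.
-/

set_option linter.dupNamespace false

namespace Summit.FinalStateConjecture.FinalStateConjecture.Cruxes.ChannelsResolveTameDevelopmentsR.CensusS5

open scoped Manifold ContDiff Topology
open Set Function Filter
open Literature.Geometry.Lorentzian
open Summit.FinalStateConjecture.FinalStateConjecture.Theses.PhotonSphereChannels

variable {X : Type} [TopologicalSpace X] [ChartedSpace E3 X] [IsManifold (𝓡 3) ∞ X] [T2Space X]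
  [SecondCountableTopology X] [ConnectedSpace X]

/-- Hypotheses (i) no extremal-Kerr late chart with vanishing C²-deviation and (ii) C³-bounded
outer geometry at a uniform scale — verbatim the two hypotheses of K2R / the last two conjuncts of
K3's property, for one development `𝒟`. -/
def TameHyps {D : InitialDataSet (𝓡 3) X} (𝒟 : VacuumCauchyDevelopment D) : Prop :=
  (∀ (Λ : Literature.Geometry.Lorentzian.lorentzGroup) (c : Literature.Geometry.Lorentzian.E4) (M a : ℝ), Literature.Geometry.Lorentzian.Kerr.IsExtremal M a → ¬ ∃ (τ₀ : ℝ) (Ψ : (Literature.Geometry.Lorentzian.boostedKerrBackground Λ c M a).domain → 𝒟.carrier), 𝒟.toSpacetime.IsLateChart (Literature.Geometry.Lorentzian.boostedKerrBackground Λ c M a) Set.univ τ₀ Ψ ∧ ∀ R : ℝ, Filter.Tendsto (fun τ => 𝒟.toSpacetime.truncDeviationCk (Literature.Geometry.Lorentzian.boostedKerrBackground Λ c M a) Ψ 2 R τ) Filter.atTop (nhds 0)) ∧ ∀ [𝒟.metric.HasLeviCivita], let outer : Set 𝒟.carrier := 𝒟.metric.causalFuture 𝒟.timeOrientation (Set.range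 𝒟.embed) ∩ {q | ∃ (p : X) (γ : ℝ → 𝒟.carrier) (dom : Set ℝ), 𝒟.metric.IsNormalisedNullRayFrom 𝒟.timeOrientation 𝒟.embed 𝒟.normal p γ dom ∧ ¬ BddAbove dom ∧ q ∈ 𝒟.metric.chronologicalPast 𝒟.timeOrientation (γ '' (dom ∩ Set.Ici 0))}; ∃ r₀ : ℝ, 0 < r₀ ∧ ∃ Λ : NNReal, ∀ q ∈ outer, let U : TopologicalSpace.Opens Literature.Geometry.Lorentzian.E4 := ⟨Metric.ball (0 : Literature.Geometry.Lorentzian.E4) r₀, Metric.isOpen_ball⟩; ∃ Ψ : U → 𝒟.carrier, 𝒟.toSpacetime.IsLateChart (Literature.Geometry.Lorentzian.Minkowski.backgroundOn U) Set.univ (-r₀) Ψ ∧ (∃ x : U, (x : Literature.Geometry.Lorentzian.E4) = 0 ∧ Ψ x = q) ∧ Literature.Geometry.Lorentzian.supCkENorm (U : Set Literature.Geometry.Lorentzian.E4) 3 (𝒟.toSpacetime.deviationExtend (Literature.Geometry.Lorentzian.Minkowski.backgroundOn U) Ψ) ≤ (Λ : ENNReal) ∧ Literature.Geometry.Lorentzian.supCkENorm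 (U : Set Literature.Geometry.Lorentzian.E4) 0 (𝒟.toSpacetime.deviationExtend (Literature.Geometry.Lorentzian.Minkowski.backgroundOn U) Ψ) ≤ 1 / 2

/-- The T2 conclusion of K2R for one development: a final state decomposition carrying the settled
exterior, the ray clause, honest-radii exhaustiveness and future orientation. -/
def ResolvedT2 {D : InitialDataSet (𝓡 3) X} (𝒟 : VacuumCauchyDevelopment D) : Prop :=
  ∃ (O : Set 𝒟.carrier) (d : Literature.Geometry.Lorentzian.FinalStateDecomposition 𝒟.toSpacetime O 2), O = _root_.Summit.FinalStateConjecture.exteriorOf 𝒟.toCauchyDevelopment d.charted ∧ _root_.Summit.FinalStateConjecture.RaysStayInClosure 𝒟.toCauchyDevelopment O ∧ _root_.Summit.FinalStateConjecture.HasExhaustiveCharts d ∧ _root_.Summit.FinalStateConjecture.IsFutureOriented d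

/-- K3's property `Q`: an MGHD exists and every MGHD has complete `𝓘⁺` and satisfies (i)–(ii). -/
def QBody (D : InitialDataSet (𝓡 3) X) : Prop :=
  (∃ 𝒟 : Literature.Geometry.Lorentzian.VacuumCauchyDevelopment D, 𝒟.IsMaximal) ∧ ∀ 𝒟 : Literature.Geometry.Lorentzian.VacuumCauchyDevelopment D, 𝒟.IsMaximal → _root_.Summit.FinalStateConjecture.HasCompleteNullInfinity 𝒟.toCauchyDevelopment ∧ TameHyps 𝒟

/-- The summit's property `P`: an MGHD exists and every MGHD has complete `𝓘⁺` and settles to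
finitely many sub-extremal Kerr black holes (T2 form). -/
def PBody (D : InitialDataSet (𝓡 3) X) : Prop :=
  (∃ 𝒟 : VacuumCauchyDevelopment D, 𝒟.IsMaximal) ∧
    ∀ 𝒟 : VacuumCauchyDevelopment D, 𝒟.IsMaximal →
      Summit.FinalStateConjecture.HasCompleteNullInfinity 𝒟.toCauchyDevelopment ∧
        ∃ (O : Set 𝒟.carrier) (d : FinalStateDecomposition 𝒟.toSpacetime O 2),
          (∀ i, Kerr.IsSubextremal (d.mass i) (d.spin i)) ∧
            O = Summit.FinalStateConjecture.exteriorOf 𝒟.toCauchyDevelopment d.charted ∧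
              Summit.FinalStateConjecture.RaysStayInClosure 𝒟.toCauchyDevelopment O ∧
                Summit.FinalStateConjecture.HasExhaustiveCharts d ∧
                  Summit.FinalStateConjecture.IsFutureOriented d

/-- K3 is tame genericity of `QBody` (definitional). -/
theorem tameCensorship_iff :
    TameCensorship ↔ ∀ (X : Type) [TopologicalSpace X] [ChartedSpace E3 X] [IsManifold (𝓡 3) ∞ X]
      [T2Space X] [SecondCountableTopology X] [ConnectedSpace X],
      InitialDataSet.IsTameChristodoulouGeneric (admissibleVacuumData X) (QBody (X := X)) 1 :=
  Iff.rfl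

/-- The summit is tame genericity of `PBody` (definitional). -/
theorem finalStateConjecture_iff :
    _root_.FinalStateConjecture ↔ ∀ (X : Type) [TopologicalSpace X] [ChartedSpace E3 X]
      [IsManifold (𝓡 3) ∞ X] [T2Space X] [SecondCountableTopology X] [ConnectedSpace X],
      InitialDataSet.IsTameChristodoulouGeneric (admissibleVacuumData X) (PBody (X := X)) 1 :=
  Iff.rfl

/-- **X₀ — pointwise resolution on admissible data**: `Q D → P D`. The weakest replacement of K2R
that the route's `closes` can consume unchanged (it is exactly what `closes` extracts from K2R). -/
def X0 : Prop :=
  ∀ (X : Type) [TopologicalSpace X] [ChartedSpace E3 X] [IsManifold (𝓡 3) ∞ X] [T2Space X]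
    [SecondCountableTopology X] [ConnectedSpace X],
    ∀ D ∈ admissibleVacuumData X, QBody D → PBody D

/-- Per development: K2R's conclusion plus hypothesis (i) give the summit's settled clause
(sub-extremality from `|aᵢ| ≤ Mᵢ` and no extremal remnant) — the step `closes` performs. -/
theorem settled_of_resolvedT2 {D : InitialDataSet (𝓡 3) X} (𝒟 : VacuumCauchyDevelopment D)
    (htame : TameHyps 𝒟) (h : ResolvedT2 𝒟) :
    ∃ (O : Set 𝒟.carrier) (d : FinalStateDecomposition 𝒟.toSpacetime O 2),
      (∀ i, Kerr.IsSubextremal (d.mass i) (d.spin i)) ∧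
        O = Summit.FinalStateConjecture.exteriorOf 𝒟.toCauchyDevelopment d.charted ∧
          Summit.FinalStateConjecture.RaysStayInClosure 𝒟.toCauchyDevelopment O ∧
            Summit.FinalStateConjecture.HasExhaustiveCharts d ∧
              Summit.FinalStateConjecture.IsFutureOriented d := by
  obtain ⟨O, d, hO, hrays, hexh, hfo⟩ := h
  refine ⟨O, d, fun i => ?_, hO, hrays, hexh, hfo⟩
  rcases lt_or_eq_of_le (d.abs_spin_le_mass i) with hlt | heq
  · exact hlt
  · exact absurd ⟨d.τ₀, d.chart i, ⟨(d.isLateChart i).contMDiff, (d.isLateChart i).isOpenEmbedding,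
        Set.subset_univ _⟩, d.tendsto_truncDeviationCk i⟩
      (htame.1 (d.motion i).1 (d.motion i).2 (d.mass i) (d.spin i) ⟨heq, d.mass_pos i⟩)

/-- **K2R ⇒ X₀** (K1R is a theorem, so K2R's antecedent is discharged). -/
theorem x0_of_k2R (h₂ : ChannelsResolveTameDevelopmentsR) : X0 := by
  intro X _ _ _ _ _ _ D hD hQ
  obtain ⟨hex, hQ⟩ := hQ
  refine ⟨hex, fun 𝒟 hmax => ?_⟩
  obtain ⟨hcomp, htame⟩ := hQ 𝒟 hmax
  exact ⟨hcomp, settled_of_resolvedT2 𝒟 htame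
    (h₂ UniformPhotonSphereChannelsR_holds X D hD 𝒟 hmax hcomp htame)⟩

/-- **X₀ + K3 ⇒ summit** (monotonicity of tame genericity) — so `X0` can replace K2R in `closes`. -/
theorem fsc_of_x0_of_tameCensorship (h₀ : X0) (h₃ : TameCensorship) : _root_.FinalStateConjecture := by
  rw [finalStateConjecture_iff]
  intro X _ _ _ _ _ _
  exact (tameCensorship_iff.mp h₃ X).mono (h₀ X)

/-- The route's deciding theorem factored through `X0`. -/
theorem fsc_of_k2R_of_tameCensorship (h₂ : ChannelsResolveTameDevelopmentsR) (h₃ : TameCensorship) :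
    _root_.FinalStateConjecture :=
  fsc_of_x0_of_tameCensorship (x0_of_k2R h₂) h₃

/-- The summit read at exceptional base data SATISFYING `Q` (tame non-settling data): through each
passes a tame injective immersed admissible curve whose other members settle. -/
def SummitOnQ : Prop :=
  ∀ (X : Type) [TopologicalSpace X] [ChartedSpace E3 X] [IsManifold (𝓡 3) ∞ X] [T2Space X]
    [SecondCountableTopology X] [ConnectedSpace X],
    ∀ d ∈ admissibleVacuumData X, QBody d → ¬ PBody d →
      ∃ (e : AFEnd X) (F : EuclideanSpace ℝ (Fin 1) → InitialDataSet (𝓡 3) X),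
        InitialDataSet.IsTameDataFamily e 1 F ∧ InitialDataSet.IsImmersedAtZero 1 F ∧ F 0 = d ∧
          Function.Injective F ∧ (∀ c, F c ∈ admissibleVacuumData X) ∧
            ∀ c ≠ 0, F c ∉ {d ∈ admissibleVacuumData X | ¬ PBody d}

/-- The summit read at exceptional base data FAILING `Q` (uncensored / extremal-remnant / wild
outer geometry data). -/
def SummitOffQ : Prop :=
  ∀ (X : Type) [TopologicalSpace X] [ChartedSpace E3 X] [IsManifold (𝓡 3) ∞ X] [T2Space X]
    [SecondCountableTopology X] [ConnectedSpace X],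
    ∀ d ∈ admissibleVacuumData X, ¬ QBody d → ¬ PBody d →
      ∃ (e : AFEnd X) (F : EuclideanSpace ℝ (Fin 1) → InitialDataSet (𝓡 3) X),
        InitialDataSet.IsTameDataFamily e 1 F ∧ InitialDataSet.IsImmersedAtZero 1 F ∧ F 0 = d ∧
          Function.Injective F ∧ (∀ c, F c ∈ admissibleVacuumData X) ∧
            ∀ c ≠ 0, F c ∉ {d ∈ admissibleVacuumData X | ¬ PBody d}

/-- **Case split of the summit along `Q`.** -/
theorem fsc_iff_split : _root_.FinalStateConjecture ↔ SummitOnQ ∧ SummitOffQ := by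
  rw [finalStateConjecture_iff]
  constructor
  · intro h
    exact ⟨fun X _ _ _ _ _ _ d hd _ hP => h X d ⟨hd, hP⟩,
      fun X _ _ _ _ _ _ d hd _ hP => h X d ⟨hd, hP⟩⟩
  · rintro ⟨hon, hoff⟩ X _ _ _ _ _ _ d ⟨hd, hP⟩
    by_cases hQ : QBody d
    · exact hon X d hd hQ hP
    · exact hoff X d hd hQ hP

/-- `X0` settles the `Q`-half VACUOUSLY: it asserts the tame-non-settling locus is empty. -/
theorem summitOnQ_of_x0 (h₀ : X0) : SummitOnQ :=
  fun X _ _ _ _ _ _ d hd hQ hP => absurd (h₀ X d hd hQ) hP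

/-- `X0` + K3 settle the `¬Q`-half: K3's curve through an uncensored datum has censored, hence
(by `X0`) settling, members. -/
theorem summitOffQ_of_x0_of_tameCensorship (h₀ : X0) (h₃ : TameCensorship) : SummitOffQ := by
  intro X _ _ _ _ _ _ d hd hQ _
  obtain ⟨e, F, hF, himm, h0, hinj, hadm, hexc⟩ := tameCensorship_iff.mp h₃ X d ⟨hd, hQ⟩
  refine ⟨e, F, hF, himm, h0, hinj, hadm, fun c hc hmem => hmem.2 (h₀ X _ hmem.1 ?_)⟩
  by_contra hQc
  exact hexc c hc ⟨hmem.1, hQc⟩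

/-- **REL — exceptional-base hand-back of settling curves along censored curves**: along every
tame admissible curve whose members off `0` satisfy `Q` and whose base datum does not settle, there
is a tame injective immersed admissible curve through the same base datum whose members off `0`
settle. -/
def REL : Prop :=
  ∀ (X : Type) [TopologicalSpace X] [ChartedSpace E3 X] [IsManifold (𝓡 3) ∞ X] [T2Space X]
    [SecondCountableTopology X] [ConnectedSpace X],
    ∀ (e : AFEnd X) (F : EuclideanSpace ℝ (Fin 1) → InitialDataSet (𝓡 3) X),
      InitialDataSet.IsTameDataFamily e 1 F →
        ((InitialDataSet.IsImmersedAtZero 1 F ∧ Injective F) ∨ ∀ c, F c = F 0) →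
          (∀ c, F c ∈ admissibleVacuumData X) → (∀ c ≠ 0, QBody (F c)) → ¬ PBody (F 0) →
            ∃ (e' : AFEnd X) (F' : EuclideanSpace ℝ (Fin 1) → InitialDataSet (𝓡 3) X),
              InitialDataSet.IsTameDataFamily e' 1 F' ∧ F' 0 = F 0 ∧ Injective F' ∧
                InitialDataSet.IsImmersedAtZero 1 F' ∧
                  (∀ c, F' c ∈ admissibleVacuumData X) ∧ ∀ c ≠ 0, PBody (F' c)

/-- **Given K3, the summit is EQUIVALENT to `REL`** — the weakest K2R-replacement modulo K3 is
summit-strength relative to K3 (in-tree `isTameChristodoulouGeneric_iff_relative_exceptional`). -/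
theorem fsc_iff_rel (h₃ : TameCensorship) : _root_.FinalStateConjecture ↔ REL := by
  rw [finalStateConjecture_iff]
  constructor
  · intro h X _ _ _ _ _ _
    exact (InitialDataSet.isTameChristodoulouGeneric_iff_relative_exceptional
      (fun d hd => exists_isSoleEnd_of_mem_admissibleVacuumData hd) (tameCensorship_iff.mp h₃ X)).mp
      (h X)
  · intro h X _ _ _ _ _ _
    exact (InitialDataSet.isTameChristodoulouGeneric_iff_relative_exceptional
      (fun d hd => exists_isSoleEnd_of_mem_admissibleVacuumData hd) (tameCensorship_iff.mp h₃ X)).mpr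
      (h X)

/-- A nonzero parameter in the one-dimensional parameter space. -/
theorem exists_ne_zero_param : ∃ c : EuclideanSpace ℝ (Fin 1), c ≠ 0 := by
  haveI : Nontrivial (EuclideanSpace ℝ (Fin 1)) :=
    Module.nontrivial_of_finrank_pos (R := ℝ) (by simp)
  exact exists_ne 0

/-- `X0 ⇒ REL`: pointwise resolution hands every censored curve back unchanged (or finds the
constant censored curve through a non-settling datum contradictory). -/
theorem rel_of_x0 (h₀ : X0) : REL := by
  intro X _ _ _ _ _ _ e F hF hdich hadm hQ hexc
  rcases hdich with ⟨himm, hinj⟩ | hconst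
  · exact ⟨e, F, hF, rfl, hinj, himm, hadm, fun c hc => h₀ X _ (hadm c) (hQ c hc)⟩
  · exfalso
    obtain ⟨c, hc⟩ := exists_ne_zero_param
    exact hexc (hconst c ▸ h₀ X _ (hadm c) (hQ c hc))

end Summit.FinalStateConjecture.FinalStateConjecture.Cruxes.ChannelsResolveTameDevelopmentsR.CensusS5
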